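import Summits.ResolutionOfSingularities.ResolutionOfSingularities.Theorems.FrobeniusClosingPatchingRelPerfectCoreRungClosure
import Literature.AlgebraicGeometry.Resolution.Principalization
import Literature.AlgebraicGeometry.Resolution.EmbeddedResolutionExcellentSurfacesSequence
import Literature.AlgebraicGeometry.Resolution.BlowupsComposition
import Literature.AlgebraicGeometry.Resolution.KollarOrderReduction

/-!
# Chain W5.2 — typed TARGETS «E» of the DEPTH-ONE programme r-d1: the DEFINITIONS half
# (plan-1 gen 5 cell file `L/res-L1-w52-plan-1/ChainW52TargetsE.lean` sha16 `9d67ec503d849faa`, VERBATIM bodies)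

[OURS · L1 W5.2] Statements (Props / one structure / one inductive) only; no `sorry`; NOT statements of the
manuscript under review (Hironaka 2017 items are candidates, never premises; nothing here cites it). This module
carries, byte-identical and in the original order and namespace, every DEFINITION of res-L1-w52-plan-1's typed
targets «E» (CRUX-PLAN v3.2 §6g; crux `PatchingRelPerfect`, item stmt-ResolutionOfSingularities-16161, rung r-d1):

* §1 `HasExceptionalDepthOne`, `IsControlledSeq`, `ControlledTrivialization₃` (Θ₃), `DepthOneConclusion`,
  `TrivializationPiece` (Piece A), `DictionaryPiece` (Piece B), `TowerContraction` (D5 — LANDED by content as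
  `towerContraction`, p493249);
* §2 `DepthOneInvariant`, `ExceptionalPackage` (I1), `DictionaryStep` (D1), `DictionaryEnd`;
* §3 `PrincipalizeControlled` (A1, hypothesis CP = `CossartPiltant2019Principalization`, F-31), `IsRegularDivisorial`,
  `RegularizeDivisorial` (A2a) and `RegularizeSupport` (A2s) (hypothesis CJS-B =
  `CossartJannsenSaito2020EmbeddedSequenceB`, F-32bR — the superseded `…EmbeddedSequence` (F-32b) is refutable as
  typed and is used NOWHERE), `DivisorialFactorization` (S-A2), `RegularizePeel` (A2).

The PROVED compositions of the same cell file (`depthOne_of_pieces`, `IsControlledSeq.of_eq/append/peel_step`,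
`comap_eq_bot_iff_le_ker'`, `dictionaryEnd_holds`, `inv_along`, `dictionaryPiece_of_steps(')`,
`regularizeDivisorial_of_support`, `peel_of_isRegularDivisorial`, `regularizePeel_of_divisorial`,
`trivializationPiece_of_steps`, `depthOne_of_targets(')`) live in the companion
`…FrobeniusClosingPatchingRelPerfectDepthOneTargets.lean`, which imports this file; docstrings below that mention
them refer to that companion. Every stub hand proves its target BY NAME against this module
(`theorem dictionaryStep_holds : DepthOneTargets.DictionaryStep`, …).

SPLIT FOR THE GATE (precedent: `Theorems/HilbertSamuelEliminationSigmaMaxModificationsCorridor3WLadderDefs.lean`,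
res-type-053, chain W4.2): (i) the gate caps Theorems files WITH proofs at 400 lines (the one-file verbatim copy,
548 l., bounced `lint.statement-form`); (ii) it RELOCATES parameterless `def … : Prop`s carrying a `[cite: …]` /
`[folklore]` tag to `Literature/` as published facts (the defs-only copy p493706 bounced `relocate`: the moved Props
no longer saw `universe u`, `HasExceptionalDepthOne`, `Spec`). Hence TWO gate-forced deviations from the cell
file, and no other: this module is the `…Defs` half, and the thirteen PARAMETERLESS Props
(`ControlledTrivialization₃`, `DepthOneConclusion`, `TrivializationPiece`, `DictionaryPiece`, `TowerContraction`,
`ExceptionalPackage`, `DictionaryStep`, `DictionaryEnd`, `PrincipalizeControlled`, `RegularizeDivisorial`,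
`RegularizeSupport`, `DivisorialFactorization`, `RegularizePeel`) carry their literature POINTERS IN PROSE
(«(cf. …)») instead of a tag — they are OURS work-order nodes shaped after the cited print, not citations of it.
Bodies, names, order, namespace and the docstrings of the parametric declarations are byte-identical.

Perfectness / residue field / characteristic / completeness / excellence of `S` are cashed NOWHERE. The two NAMED
FACTS enter ONLY as hypotheses of the Piece-A targets; everything on the fourfold side (Piece B) is fact-free.

## References (pointers of the OURS nodes; the parametric declarations keep their tags)
* Q. Liu, *Algebraic Geometry and Arithmetic Curves* (2002), Thm. 8.1.19 (a). [Liu2002]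
* V. Cossart, O. Piltant, J. Algebra 529 (2019), Prop. 4.4 (i). [CossartPiltant2019]
* V. Cossart, U. Jannsen, S. Saito, LNM 2270 (2020), Thm. 1.4, Cor. 1.5, (6.2), Def. 6.8, Thm. 6.9 (a).
  [CossartJannsenSaito2020]
* J. Kollár, *Lectures on Resolution of Singularities* (2007), 3.30.2, (3.111) Step 3. [Kollar2007]
* U. Görtz, T. Wedhorn, *Algebraic Geometry I* (2nd ed. 2020), Prop. 13.91 (1), 13.96 (2), (13.19). [GortzWedhorn2020]
* E. Bierstone, D. Grigoriev, P. Milman, J. Włodarczyk, arXiv:1206.3090, §3.2. [BierstoneGrigorievMilmanWlodarczyk2011]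
* The Stacks Project, Tags 080A, 080B. [StacksProject]
-/

noncomputable section

open CategoryTheory CategoryTheory.Limits AlgebraicGeometry TopologicalSpace
open Literature.AlgebraicGeometry.Resolution

set_option linter.dupNamespace false

namespace Summit.ResolutionOfSingularities.ResolutionOfSingularities.Theorems.DepthOneTargets

universe u

/-! ## §1 The depth-one class, controlled sequences, Θ₃, the conclusion, the two pieces (verbatim «D») -/

/-- [OURS · L1 W5.2] **Exceptional depth one**: `I ⊆ 𝔪ᵈ` and `x_i^{d+1} ∈ I` for every member `x_i`
of a family spanning `𝔪`, for some `d`. On every Rees chart of `Bl_𝔪 Spec S` the weak transform of `I`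
then contains the exceptional equation: `I𝒪 = wᵈ · ((w) + 𝔟̃)` with `𝔟` an ideal sheaf of the
exceptional divisor `E ≅ ℙ³_κ` (the base ideal of the initial linear system `in_d I`).
[cite: Liu2002, Thm. 8.1.19 (a)] -/
def HasExceptionalDepthOne {S : Type u} [CommRing S] [IsLocalRing S] {n : ℕ} (x : Fin n → S)
    (I : Ideal S) : Prop :=
  ∃ d : ℕ, I ≤ IsLocalRing.maximalIdeal S ^ d ∧ ∀ i : Fin n, x i ^ (d + 1) ∈ I

/-- [OURS · L1 W5.2] **Controlled sequence.** `IsControlledSeq ρ 𝔟 𝔟'`: `ρ : E' ⟶ E` is a finite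
composite of blowing ups along centres `C_j` (ideal sheaves whose closed subscheme `V(C_j)` is a REGULAR
scheme — the centre shape of both `IsRegularCentreBlowupSeq` (CP 2019, `C = vanishingIdeal Y`) and
`IsBPermissibleSequence` (CJS 2020)) with `𝔟_j ≤ C_j` (centre inside the cosupport), and `𝔟'` is the
iterated CONTROLLED transform: at each step `𝔟_j 𝒪_{E_{j+1}} = C_j𝒪_{E_{j+1}} · 𝔟_{j+1}`. Integrality /
connectedness of the centres is NOT required; codimension-one centres ARE allowed (blowing up a Cartier
divisor is an isomorphism: the PEELING step). [cite: CossartPiltant2019, Prop. 4.4 (i)]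
[cite: CossartJannsenSaito2020, (6.2), Def. 6.8] [cite: Kollar2007, (3.111) Step 3] -/
inductive IsControlledSeq :
    ∀ {E' E : Scheme.{u}}, (E' ⟶ E) → E.IdealSheafData → E'.IdealSheafData → Prop
  /-- the empty sequence -/
  | nil {E : Scheme.{u}} (𝔟 : E.IdealSheafData) : IsControlledSeq (𝟙 E) 𝔟 𝔟
  /-- one more blowing up along a regular centre `C ⊇ 𝔟'`, with `𝔟''` the controlled transform -/
  | cons {E'' E' E : Scheme.{u}} (τ : E'' ⟶ E') (ρ : E' ⟶ E) (𝔟 : E.IdealSheafData)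
      (𝔟' : E'.IdealSheafData) (𝔟'' : E''.IdealSheafData) (C : E'.IdealSheafData) :
      IsControlledSeq ρ 𝔟 𝔟' →
      Scheme.IsRegular C.subscheme →
      𝔟' ≤ C →
      IsBlowup τ C →
      𝔟'.comap τ = C.comap τ * 𝔟'' →
      IsControlledSeq (τ ≫ ρ) 𝔟 𝔟''

/-- [OURS · L1 W5.2] **Θ₃ — controlled trivialization on regular excellent threefolds.** For every
regular, excellent, integral Noetherian scheme `E` of dimension three and every non-zero ideal sheaf `𝔟`
on `E` there is a controlled sequence ending with the unit ideal. Intended proof (CRUX-PLAN v3.1 §6e;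
tri-1 HUNT §8c): CP principalization (centres in the non-principal locus of the total transform, which
equals that of the controlled transform since they differ by an invertible factor) ⇒ `𝔟_A = 𝒪(−D)`
invertible; CJS Thm. 1.4 (sequence form) for `X = (Supp D)_red ⊂ E_A` (centres inside the strict
transform `X_j ⊆ Supp D_j`) ⇒ every component of `Supp D_B` is a regular surface, locally a regular
parameter; peel the components one exponent at a time (codimension-one centres).
(cf. CossartPiltant2019, Prop. 4.4; CossartJannsenSaito2020, Thm. 1.4; Kollar2007, (3.111) Step 3 —
OURS node; pointer in prose, see module doc.) -/
def ControlledTrivialization₃ : Prop :=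
  ∀ (E : Scheme.{u}) [IsIntegral E] [IsNoetherian E], Scheme.IsRegular E → Scheme.IsExcellent E →
    topologicalKrullDim E = 3 → ∀ 𝔟 : E.IdealSheafData, 𝔟 ≠ ⊥ →
      ∃ (E' : Scheme.{u}) (ρ : E' ⟶ E), IsControlledSeq ρ 𝔟 ⊤

/-- [OURS · L1 W5.2] **The depth-one rung, conclusion** (blow-up form of the registered core
`stub_atomDimFourBlowup`, on the depth-one stratum): `S` regular local of Krull dimension `4` — ANY
characteristic, ANY residue field, no completeness, no excellence —, `x` a family spanning `𝔪`,
`I ≠ 0` of exceptional depth one; then every blowing up `T → Spec S` along `I` carries a non-zero ideal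
sheaf cosupported in the closed fibre whose blowing up is regular. NOT a statement of the manuscript.
(cf. CossartPiltant2019, Prop. 4.4; CossartJannsenSaito2020, Thm. 1.4 — OURS node; pointer in prose,
see module doc.) -/
def DepthOneConclusion : Prop :=
  ∀ (S : Type u) [CommRing S] [IsRegularLocalRing S], ringKrullDim S = (4 : ℕ) →
    ∀ (n : ℕ) (x : Fin n → S), Ideal.span (Set.range x) = IsLocalRing.maximalIdeal S →
    ∀ (I : Ideal S), I ≠ ⊥ → HasExceptionalDepthOne x I →
    ∀ (T : Scheme.{u}) (f : T ⟶ Spec (.of S)), IsBlowup f (affineBlowup.idealSheaf I) →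
      ∃ (J : T.IdealSheafData) (T' : Scheme.{u}) (π : T' ⟶ T), J ≠ ⊥ ∧
        (∀ t : T, t ∈ J.support → f.base t = IsLocalRing.closedPoint S) ∧
        IsBlowup π J ∧ Scheme.IsRegular T'

/-- [OURS · L1 W5.2] **Piece A (scheme-level, dimension three): the named facts give Θ₃** (CJS in the
repaired sequence form `CossartJannsenSaito2020EmbeddedSequenceB`, F-32bR).
(cf. CossartPiltant2019, Prop. 4.4; CossartJannsenSaito2020, Thm. 1.4, Thm. 6.9 (a) — OURS node;
pointer in prose, see module doc.) -/
def TrivializationPiece : Prop :=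
  CossartPiltant2019Principalization.{u} → CossartJannsenSaito2020EmbeddedSequenceB.{u} →
    ControlledTrivialization₃.{u}

/-- [OURS · L1 W5.2] **Piece B (the fourfold dictionary, fact-free): Θ₃ gives the depth-one rung.**
D0: `X₁ = Bl_𝔪 Spec S ⊃ E ≅ ℙ³_κ` (regular, excellent, integral, dimension `3`), `I𝒪_{X₁} = wᵈ·((w)+𝔟̃)`;
D1 (one step): for a centre `C ⊂ 𝒪_{E_j}` with `V(C)` regular and `𝔟_j ≤ C`, pushed into `X_j ⊃ E_j`,
`X_{j+1} = Bl_{V(C)} X_j` is regular (`IsBlowup.isRegular_of_isRegular_subscheme`), `E_{j+1} =` strict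
transform `= Bl_{C} E_j` (`IsBlowup.strictTransformHom`), and `((w_j)+𝔟̃_j)𝒪 = 𝓘_{exc}·((w_{j+1})+𝔟̃_{j+1})`
with `𝔟_{j+1}` the controlled transform (chart identity; tri-1's format lemma at one layer); D5:
`TowerContraction`. Perfectness is cashed nowhere. -/
def DictionaryPiece : Prop :=
  ControlledTrivialization₃.{u} → DepthOneConclusion.{u}

/-- [OURS · L1 W5.2] **D5 — contraction of a closed-point tower** (stub-sized, scheme-level over
`Spec S`): if `g : X → Spec S` is a blowing up along an ideal sheaf cosupported in the closed point
(which every composite of blowing ups at centres over the closed point is, by iterating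
`IsBlowup.exists_isBlowup_comp_supported`, Stacks 080B), `X` is regular and `I𝒪_X` is locally
principal, then `I` is in the companion class `𝒞` (shape of `atomConclusion_of_companion'`):
`K = Q̃` for an `𝔪`-primary (or unit) `Q` (`affineBlowup.exists_eq_idealSheaf'`), and `g` is also the
blowing up along `(I·Q)̃` (Stacks 080A, `IsBlowup.mul_of_isEffectiveCartier`).
(cf. StacksProject, Tag 080A; StacksProject, Tag 080B — OURS node; pointer in prose, see module
doc.) -/
def TowerContraction : Prop :=
  ∀ (S : Type u) [CommRing S] [IsRegularLocalRing S] (I : Ideal S), I ≠ ⊥ →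
    ∀ (X : Scheme.{u}) (g : X ⟶ Spec (.of S)) (K : (Spec (.of S)).IdealSheafData),
      IsBlowup g K → (K.support : Set (Spec (.of S))) ⊆ {IsLocalRing.closedPoint S} →
      Scheme.IsRegular X → IsLocallyPrincipal ((affineBlowup.idealSheaf I).comap g) →
        ∃ (Q : Ideal S) (m : ℕ), IsLocalRing.maximalIdeal S ^ m ≤ Q ∧
          ∃ (B : Scheme.{u}) (b : B ⟶ Spec (.of S)),
            IsBlowup b (affineBlowup.idealSheaf (I * Q)) ∧ Scheme.IsRegular B

/-! ## §1b Two elementary closure properties of controlled sequences (PROVED) -/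

/-! ## §2 Piece B (the fourfold dictionary), broken into stub-sized targets -/

/-- [OURS · L1 W5.2] **The depth-one invariant** (X-side bookkeeping along the controlled sequence on
the exceptional threefold). `S` regular local, `I ⊆ S`; `g : X → Spec S` a blowing up along an ideal
sheaf cosupported in the closed point, `X` Noetherian and regular; `i : E ⟶ X` a closed immersion whose
ideal `𝓘_E = i.ker` is an effective Cartier divisor, `E` regular and mapped to the closed point; and the
FORMAT `I𝒪_X = M · K` with `M` an effective Cartier (invertible) ideal, `𝓘_E ≤ K` and `K|_E = i^*K = 𝔟`
— on a chart, `K = (w) + 𝔟̂` with `w` a local equation of `E`. At the start (`ExceptionalPackage`)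
`X = Bl_𝔪 Spec S`, `E` its exceptional divisor, `M = 𝓘_E^d`; after each `DictionaryStep`,
`M ↦ σ^*M · 𝓘_{exc}` and `K ↦` the controlled transform `(σ^*K : 𝓘_{exc})`.
[cite: Kollar2007, (3.111) Step 3] [cite: GortzWedhorn2020, Prop. 13.91 (1), 13.96 (2)] -/
structure DepthOneInvariant (S : Type u) [CommRing S] [IsRegularLocalRing S] (I : Ideal S)
    (E X : Scheme.{u}) (i : E ⟶ X) (g : X ⟶ Spec (.of S)) (𝔟 : E.IdealSheafData) : Prop where
  /-- `X` is Noetherian -/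
  isNoetherian : IsNoetherian X
  /-- `X` is regular -/
  isRegular : Scheme.IsRegular X
  /-- `E` is regular -/
  isRegular_exc : Scheme.IsRegular E
  /-- `i : E ⟶ X` is a closed immersion … -/
  isClosedImmersion : IsClosedImmersion i
  /-- … whose ideal is an effective Cartier divisor -/
  isEffectiveCartier_ker : IsEffectiveCartier i.ker
  /-- `E` lies over the closed point of `Spec S` -/
  map_eq_closedPoint : ∀ e : E, g.base (i.base e) = IsLocalRing.closedPoint S
  /-- `g` is a blowing up along an ideal sheaf cosupported in the closed point -/
  exists_isBlowup_supported : ∃ K : (Spec (.of S)).IdealSheafData, IsBlowup g K ∧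
    (K.support : Set (Spec (.of S))) ⊆ {IsLocalRing.closedPoint S}
  /-- the FORMAT `I𝒪_X = M · K`, `M` invertible, `𝓘_E ≤ K`, `K|_E = 𝔟` -/
  exists_format : ∃ M K : X.IdealSheafData, IsEffectiveCartier M ∧ i.ker ≤ K ∧ K.comap i = 𝔟 ∧
    (affineBlowup.idealSheaf I).comap g = M * K

/-- [OURS · L1 W5.2] **I1 — the exceptional package (D0).** For `S` regular local of dimension four,
`x` spanning `𝔪` and `I ≠ 0` of exceptional depth one, the invariant holds at an initial state with `E`
integral, Noetherian, excellent of dimension three. Intended witnesses: `g : X ⟶ Spec S` ANY blowing up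
along `𝔪̃ = affineBlowup.idealSheaf 𝔪` (`exists_isBlowup`; `X` regular by
`IsBlowup.isRegular_of_isRegular_subscheme` or the chart description), `E = (𝔪̃.comap g).subscheme`,
`i = subschemeι` (regular: `IsBlowup.isRegular_subscheme_comap`; reduced + irreducible:
`IsBlowup.isReduced_subscheme_comap`, `affineBlowup.isIrreducible_preimage_of_isQuasiRegular`; charts
`exists_ringEquiv_sections_chart_mvPolynomial` give `E ≅ ℙ³_κ` locally `𝔸³_κ`, whence excellence via
`Scheme.IsExcellent.of_locallyOfFiniteType` over `Spec κ` — `S` itself is NOT assumed excellent — and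
`topologicalKrullDim E = 3`), `M = (𝔪̃.comap g)^d`, `K = (Ĩ.comap g : M) = 𝓘_E + 𝔟̂` from
`I ⊆ 𝔪ᵈ ∌̸ x_i^{d+1}` (`HasExceptionalDepthOne`; on the chart `S[𝔪/x_i]`: `I = x_iᵈ · I_i` with
`x_i ∈ I_i`). `𝔟 = ⊥` is allowed (e.g. `I = 𝔪^{d+1}`).
(cf. Liu2002, Thm. 8.1.19 (a); Kollar2007, (3.111) Step 3 — OURS node; pointer in prose, see module
doc.) -/
def ExceptionalPackage : Prop :=
  ∀ (S : Type u) [CommRing S] [IsRegularLocalRing S], ringKrullDim S = (4 : ℕ) →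
    ∀ (n : ℕ) (x : Fin n → S), Ideal.span (Set.range x) = IsLocalRing.maximalIdeal S →
    ∀ (I : Ideal S), I ≠ ⊥ → HasExceptionalDepthOne x I →
      ∃ (X E : Scheme.{u}) (g : X ⟶ Spec (.of S)) (i : E ⟶ X) (𝔟 : E.IdealSheafData),
        DepthOneInvariant S I E X i g 𝔟 ∧ IsIntegral E ∧ IsNoetherian E ∧ Scheme.IsExcellent E ∧
          topologicalKrullDim E = 3

/-- [OURS · L1 W5.2] **D1 at scheme level — the dictionary step.** One controlled step on the threefold
(`τ : E' ⟶ E` a blowing up along a centre `C ⊇ 𝔟` with `V(C)` regular, `𝔟𝒪_{E'} = C𝒪_{E'} · 𝔟'`) is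
matched by one blowing up of the fourfold preserving the invariant. Intended proof: `Ĉ ⊆ 𝒪_X` the ideal
of `V(C) ⊂ E ⊂ X` (`Ĉ ⊇ i.ker`, `i^*Ĉ = C`, `V(Ĉ) ≅ V(C)` regular); `σ : X' ⟶ X` by `exists_isBlowup X Ĉ`;
`X'` regular (`IsBlowup.isRegular_of_isRegular_subscheme`) and Noetherian; `g' = σ ≫ g` cosupported in the
closed point (`IsBlowup.exists_isBlowup_comp_supported`, `V(Ĉ) ⊆ E ↦ 𝔪`); `i' = hσ.strictTransformHom hτ`
(`hτ : IsBlowup τ (Ĉ.comap i)`), a closed immersion (`StrictTransformClosedImmersion_holds`), with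
`i'.ker = (σ^*𝓘_E : 𝓘_{exc})` effective Cartier (`IsBlowup.ker_strictTransformHom_of_maxOrder`, `μ = 1`:
`𝓘_E` has order one along the regular centre); FORMAT: `σ^*K = 𝓘_{exc} · K'`
(`IsBlowup.comap_mul_controlledTransform_one`, `K ≤ Ĉ`), `M' = σ^*M · 𝓘_{exc}`, `𝓘_{E'} ≤ K'` and
`i'^*K' = 𝔟'` — the chart identity of the ring-level dictionary `Theorems.DepthOne.*` (p489709:
`map_span_sup_algebraMap_succ/_zero`, `exists_strictTransformEquiv`, `map_colon_eq_colon_map`) in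
regular parameters `(u, z)` adapted to `E ⊃ V(C)` (`exists_isQuasiRegular_away_of_isRegularRing`), the
given `𝔟'` being forced by cancellation of the effective Cartier divisor `C𝒪_{E'}`
(`IsEffectiveCartier.eq_of_mul_eq_mul`).
(cf. GortzWedhorn2020, Prop. 13.91 (1), 13.96 (2); Kollar2007, 3.30.2, (3.111) Step 3;
BierstoneGrigorievMilmanWlodarczyk2011, §3.2 — OURS node; pointer in prose, see module doc.) -/
def DictionaryStep : Prop :=
  ∀ (S : Type u) [CommRing S] [IsRegularLocalRing S] (I : Ideal S)
    (E X : Scheme.{u}) (i : E ⟶ X) (g : X ⟶ Spec (.of S)) (𝔟 : E.IdealSheafData),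
    DepthOneInvariant S I E X i g 𝔟 →
    ∀ (E' : Scheme.{u}) (τ : E' ⟶ E) (C : E.IdealSheafData) (𝔟' : E'.IdealSheafData),
      Scheme.IsRegular C.subscheme → 𝔟 ≤ C → IsBlowup τ C → 𝔟.comap τ = C.comap τ * 𝔟' →
        ∃ (X' : Scheme.{u}) (i' : E' ⟶ X') (g' : X' ⟶ Spec (.of S)), DepthOneInvariant S I E' X' i' g' 𝔟'

/-- [OURS · L1 W5.2] **The dictionary's end** (XS): when the threefold ideal is trivial (`𝔟 = ⊤`: then
`V(K) ⊆ E` and `V(K) ∩ E = ∅`, so `K = ⊤` and `I𝒪_X = M`) or zero (`𝔟 = ⊥`: then `K ≤ i.ker` by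
`comap_eq_bot_iff_le_ker`, so `K = 𝓘_E` and `I𝒪_X = M · 𝓘_E`), `I𝒪_X` is locally principal (a product
of effective Cartier ideals).
(cf. GortzWedhorn2020, (13.19) p. 414 — folklore — OURS node; pointer in prose, see module doc.) -/
def DictionaryEnd : Prop :=
  ∀ (S : Type u) [CommRing S] [IsRegularLocalRing S] (I : Ideal S)
    (E X : Scheme.{u}) (i : E ⟶ X) (g : X ⟶ Spec (.of S)) (𝔟 : E.IdealSheafData),
    DepthOneInvariant S I E X i g 𝔟 → (𝔟 = ⊤ ∨ 𝔟 = ⊥) →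
      IsLocallyPrincipal ((affineBlowup.idealSheaf I).comap g)

/-! ## §3 Piece A (the threefold trivialization), broken into stub-sized targets -/

/-- [OURS · L1 W5.2] **A1 — controlled principalization** (consumes CP 2019 Prop. 4.4): on a regular,
excellent, integral Noetherian threefold every non-zero ideal sheaf is carried by a controlled sequence
to a non-zero LOCALLY PRINCIPAL ideal sheaf, the last threefold being again regular, excellent, integral,
Noetherian of dimension three. Intended proof: CP's `IsRegularCentreBlowupSeq` has regular centres
`Y_j` inside the non-principal locus of the TOTAL transform `𝔟𝒪_{E_j}`, which is the non-principal locus of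
the controlled transform `𝔟_j` (they differ by the invertible factor `∏ C_k𝒪`), so `𝔟_j ≤ 𝓘(Y_j)`
(`V(𝓘(Y_j))` reduced inside `Supp 𝔟_j`) and `𝔟_{j+1} := (τ^*𝔟_j : 𝓘(Y_j)𝒪)`
(`IsBlowup.comap_mul_controlledTransform_one`); regularity / excellence / integrality / dimension persist
under blowing up regular centres (`IsBlowup.isRegular_of_isRegular_subscheme`, `IsBlowup.isQuasiExcellent`,
birationality). WHY IT MIGHT FAIL: only through a mismatch between CP's typed centre condition and
`𝔟_j ≤ C_j`.
(cf. CossartPiltant2019, Prop. 4.4 (i) — OURS node; pointer in prose, see module doc.) -/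
def PrincipalizeControlled : Prop :=
  CossartPiltant2019Principalization.{u} →
  ∀ (E : Scheme.{u}) [IsIntegral E] [IsNoetherian E], Scheme.IsRegular E → Scheme.IsExcellent E →
    topologicalKrullDim E = 3 → ∀ 𝔟 : E.IdealSheafData, 𝔟 ≠ ⊥ →
      ∃ (E' : Scheme.{u}) (ρ : E' ⟶ E) (𝔟' : E'.IdealSheafData),
        IsControlledSeq ρ 𝔟 𝔟' ∧ IsLocallyPrincipal 𝔟' ∧ 𝔟' ≠ ⊥ ∧
        IsIntegral E' ∧ IsNoetherian E' ∧ Scheme.IsRegular E' ∧ Scheme.IsExcellent E' ∧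
        topologicalKrullDim E' = 3

/-- [OURS · L1 W5.2] **Regular-divisorial ideal sheaves**: `𝔟` is a finite product (with repetitions)
of ideals `D_k` each of which is an effective Cartier divisor with REGULAR closed subscheme `V(D_k)`.
Such an ideal is peeled to `⊤` by codimension-one controlled steps (`peel_of_isRegularDivisorial`).
[cite: Kollar2007, (3.111) Step 3] -/
def IsRegularDivisorial {E : Scheme.{u}} (𝔟 : E.IdealSheafData) : Prop :=
  ∃ l : List E.IdealSheafData,
    (∀ D ∈ l, IsEffectiveCartier D ∧ Scheme.IsRegular D.subscheme) ∧ 𝔟 = l.prod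

/-- [OURS · L1 W5.2] **A2a — regularization of the support** (consumes CJS 2020 Thm. 1.4, sequence form
WITH boundary, typed `CossartJannsenSaito2020EmbeddedSequenceB` = F-32bR; its per-step clause «centre points
singular on `X_j` OR on `B_j`» is not used here, only `hsub`, regularity of the centres and the end clauses):
a non-zero locally principal ideal sheaf
`𝔟 = 𝒪(−D)` on a regular excellent integral Noetherian threefold is carried by a controlled sequence to a
regular-divisorial one. Intended proof: CJS for the reduced surface `X = (Supp D)_red ↪ E`
(`….of_isClosed`): a `𝓑`-permissible sequence `π : E₁ → E` (regular centres inside the strict transforms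
`X_j ⊆ Supp 𝔟_j`, so `𝔟_j ≤ C_j`, `C_j` being radical; `𝔟_{j+1} := (τ^*𝔟_j : C_j𝒪)`) with `X₁` regular,
`B₁` a strict normal crossings divisor, `π⁻¹(X) = X₁ ∪ B₁`, `X₁ ⋔ B₁`; then `𝔟₁` is invertible with
support in the finite union of the REGULAR prime divisors `{components of X₁} ∪ {components of B₁}`, and
on the regular (locally: `R` regular local, `V(f) ⊆ ⋃ V(z_k)`, `z_k` regular parameters) scheme `E₁`,
`𝔟₁ = ∏ 𝓘(D_k)^{a_k}` (divide out `z_k` while possible — Krull intersection —, the cofactor is a unit by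
Krull's principal ideal theorem; NO unique factorisation needed). WHY IT MIGHT FAIL: the typed fact's
conclusions (`IsStrictNormalCrossingsDivisor`, regularity of `closure X₁` as a reduced subscheme) must
yield `Scheme.IsRegular (𝓘(D_k)).subscheme` for EVERY component, incl. the exceptional ones — this is
exactly what the boundary `B₁` is for.
(cf. CossartJannsenSaito2020, Thm. 1.4 ("More precisely"), Cor. 1.5; Kollar2007, (3.111) Step 3 —
OURS node; pointer in prose, see module doc.) -/
def RegularizeDivisorial : Prop :=
  CossartJannsenSaito2020EmbeddedSequenceB.{u} →
  ∀ (E : Scheme.{u}) [IsIntegral E] [IsNoetherian E], Scheme.IsRegular E → Scheme.IsExcellent E →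
    topologicalKrullDim E = 3 → ∀ 𝔟 : E.IdealSheafData, 𝔟 ≠ ⊥ → IsLocallyPrincipal 𝔟 →
      ∃ (E' : Scheme.{u}) (ρ : E' ⟶ E) (𝔟' : E'.IdealSheafData),
        IsControlledSeq ρ 𝔟 𝔟' ∧ IsRegularDivisorial 𝔟'

/-- [OURS · L1 W5.2] **A2s — regularization of the support, CJS plumbing only** (consumes CJS 2020
Thm. 1.4 with boundary): as `RegularizeDivisorial`, but concluding only that the end ideal `𝔟'` is non-zero,
locally principal, on a regular integral Noetherian `E'`, with support inside a FINITE union of closed sets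
`D_k` whose ideal `𝓘(D_k) = vanishingIdeal D_k` is an effective Cartier divisor with regular `V(𝓘(D_k))`
(intended: the components of the regular strict transform `X₁` and of the strict normal crossings boundary
`B₁`, `π⁻¹(Supp 𝔟) = X₁ ∪ B₁`; `IsStrictNormalCrossingsDivisor.exists_regularSystemOfParameters`). The
fact-free remainder is `DivisorialFactorization`.
(cf. CossartJannsenSaito2020, Thm. 1.4, Cor. 1.5 — OURS node; pointer in prose, see module doc.) -/
def RegularizeSupport : Prop :=
  CossartJannsenSaito2020EmbeddedSequenceB.{u} →
  ∀ (E : Scheme.{u}) [IsIntegral E] [IsNoetherian E], Scheme.IsRegular E → Scheme.IsExcellent E →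
    topologicalKrullDim E = 3 → ∀ 𝔟 : E.IdealSheafData, 𝔟 ≠ ⊥ → IsLocallyPrincipal 𝔟 →
      ∃ (E' : Scheme.{u}) (ρ : E' ⟶ E) (𝔟' : E'.IdealSheafData) (s : Finset (Closeds E')),
        IsControlledSeq ρ 𝔟 𝔟' ∧ IsIntegral E' ∧ IsNoetherian E' ∧ Scheme.IsRegular E' ∧
        𝔟' ≠ ⊥ ∧ IsLocallyPrincipal 𝔟' ∧
        (∀ D ∈ s, IsEffectiveCartier (Scheme.IdealSheafData.vanishingIdeal D) ∧
          Scheme.IsRegular (Scheme.IdealSheafData.vanishingIdeal D).subscheme) ∧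
        (𝔟'.support : Set E') ⊆ ⋃ D ∈ s, (D : Set E')

/-- [OURS · L1 W5.2] **S-A2 — divisorial factorisation on a regular scheme** (fact-free, stub-sized): a
non-zero locally principal ideal sheaf on a regular integral Noetherian scheme whose support lies in a
finite union of closed sets `D_k` with `𝓘(D_k)` effective Cartier and `V(𝓘(D_k))` regular is
regular-divisorial (a finite product of such ideals — of the irreducible components `P_α` of the `D_k`,
which are open-closed in the regular `V(𝓘(D_k))`). Locally: `R` regular local, `f ≠ 0`,
`V(f) ⊆ ⋃ V(z_α)` with `R/z_α` regular of dimension `dim R − 1` (so each `z_α` is a prime element and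
`(z_α)` has height one); divide `f` by each `z_α` while possible (Krull's intersection theorem), the
cofactor `g ∉ ⋃ (z_α)` has `V(g) ⊆ ⋃ V(z_α)`, hence is a unit by Krull's principal ideal theorem; the
exponents are the valuations of `𝔟` at the generic points of the `P_α`. NO unique factorisation is used.
WHY IT MIGHT FAIL: only the Lean plumbing (irreducible components, stalk-local equality of ideal sheaves).
(cf. Kollar2007, (3.111) Step 3; Liu2002, Thm. 8.1.19 (a) — OURS node; pointer in prose, see module
doc.) -/
def DivisorialFactorization : Prop :=
  ∀ (E : Scheme.{u}) [IsIntegral E] [IsNoetherian E], Scheme.IsRegular E →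
    ∀ 𝔟 : E.IdealSheafData, 𝔟 ≠ ⊥ → IsLocallyPrincipal 𝔟 →
    ∀ s : Finset (Closeds E),
      (∀ D ∈ s, IsEffectiveCartier (Scheme.IdealSheafData.vanishingIdeal D) ∧
        Scheme.IsRegular (Scheme.IdealSheafData.vanishingIdeal D).subscheme) →
      (𝔟.support : Set E) ⊆ (⋃ D ∈ s, (D : Set E)) → IsRegularDivisorial 𝔟

/-- [OURS · L1 W5.2] **A2 — regularize and peel** (consumes CJS): from non-zero locally principal to the
unit ideal by a controlled sequence. `= RegularizeDivisorial` followed by the proved peeling. -/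
def RegularizePeel : Prop :=
  CossartJannsenSaito2020EmbeddedSequenceB.{u} →
  ∀ (E : Scheme.{u}) [IsIntegral E] [IsNoetherian E], Scheme.IsRegular E → Scheme.IsExcellent E →
    topologicalKrullDim E = 3 → ∀ 𝔟 : E.IdealSheafData, 𝔟 ≠ ⊥ → IsLocallyPrincipal 𝔟 →
      ∃ (E' : Scheme.{u}) (ρ : E' ⟶ E), IsControlledSeq ρ 𝔟 ⊤

/-! ## §4 The depth-one rung from the five open targets (PROVED composition) -/

end Summit.ResolutionOfSingularities.ResolutionOfSingularities.Theorems.DepthOneTargets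

end
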